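import Summits.Ventures.HodgeRepro.FaceCensusEngine
import Summits.Ventures.HodgeRepro.EngineMasks

/-!
# EngineNormalize — `normalize` is a canonical form (seat p4)

`normalize S = (sortNat S).eraseDups` is strictly sorted and determined by membership (`normalize_eq_iff`), so two
normalised type sets are equal iff they have the same members; `eraseDups` is a nodup sublist with the same `toFinset`.
-/

namespace Summit.Ventures.HodgeRepro.FaceCensus

/-! ### `normalize` is a canonical form -/

section Normalize

/-- Sorted insertion keeps a weakly increasing list weakly increasing. -/
theorem insertNat_pairwise_le (a : ℕ) (l : List ℕ) (hl : l.Pairwise (· ≤ ·)) :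
    (insertNat a l).Pairwise (· ≤ ·) := by
  induction l with
  | nil => simp [insertNat]
  | cons b l ih =>
    simp only [insertNat]
    rw [List.pairwise_cons] at hl
    obtain ⟨hb, hl⟩ := hl
    split_ifs with hab
    · rw [List.pairwise_cons]
      refine ⟨fun x hx => ?_, List.pairwise_cons.2 ⟨hb, hl⟩⟩
      rw [List.mem_cons] at hx
      rcases hx with rfl | hx
      · exact hab
      · exact hab.trans (hb x hx)
    · rw [List.pairwise_cons]
      refine ⟨fun x hx => ?_, ih hl⟩
      rw [mem_insertNat] at hx
      rcases hx with rfl | hx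
      · omega
      · exact hb x hx

/-- `sortNat l` is weakly increasing. -/
theorem sortNat_pairwise_le (l : List ℕ) : (sortNat l).Pairwise (· ≤ ·) := by
  induction l with
  | nil => simp [sortNat]
  | cons a l ih => exact insertNat_pairwise_le a _ ih

/-- `l.eraseDups` is a sublist of `l`. -/
theorem eraseDups_sublist {α : Type*} [BEq α] [LawfulBEq α] (l : List α) : l.eraseDups.Sublist l := by
  induction h : l.length using Nat.strong_induction_on generalizing l with
  | _ n ih =>
    cases l with
    | nil => simp
    | cons a as =>
      rw [List.eraseDups_cons]
      have hlen : (as.filter fun b => !b == a).length < n := by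
        rw [← h, List.length_cons]
        exact Nat.lt_succ_of_le (List.length_filter_le _ _)
      exact ((ih _ hlen _ rfl).trans List.filter_sublist).cons_cons a

/-- `l.eraseDups` has no duplicates. -/
theorem eraseDups_nodup {α : Type*} [BEq α] [LawfulBEq α] (l : List α) : l.eraseDups.Nodup := by
  induction h : l.length using Nat.strong_induction_on generalizing l with
  | _ n ih =>
    cases l with
    | nil => simp
    | cons a as =>
      rw [List.eraseDups_cons, List.nodup_cons]
      have hlen : (as.filter fun b => !b == a).length < n := by
        rw [← h, List.length_cons]
        exact Nat.lt_succ_of_le (List.length_filter_le _ _)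
      refine ⟨fun hmem => ?_, ih _ hlen _ rfl⟩
      rw [List.mem_eraseDups, List.mem_filter] at hmem
      simp at hmem

/-- `normalize l` is strictly increasing. -/
theorem normalize_pairwise_lt (l : List ℕ) : (normalize l).Pairwise (· < ·) := by
  have h1 : (normalize l).Pairwise (· ≤ ·) := (sortNat_pairwise_le l).sublist (eraseDups_sublist _)
  have h2 : (normalize l).Nodup := eraseDups_nodup _
  exact (h1.and h2).imp fun h => lt_of_le_of_ne h.1 h.2

/-- `normalize l` has no duplicates. -/
theorem normalize_nodup (l : List ℕ) : (normalize l).Nodup := eraseDups_nodup _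

/-- **`normalize` is a canonical form**: two normalised lists are equal iff the lists have the same members. -/
theorem normalize_eq_iff (S S' : List ℕ) : normalize S = normalize S' ↔ ∀ x, x ∈ S ↔ x ∈ S' := by
  constructor
  · intro h x
    rw [← mem_normalize x S, h, mem_normalize]
  · intro h
    exact (normalize_pairwise_lt S).eq_of_mem_iff (normalize_pairwise_lt S') fun x => by
      rw [mem_normalize, mem_normalize]
      exact h x

/-- A strictly increasing list is its own normalisation. -/
theorem normalize_eq_self_of_pairwise_lt {S : List ℕ} (h : S.Pairwise (· < ·)) : normalize S = S :=
  (normalize_pairwise_lt S).eq_of_mem_iff h fun x => mem_normalize x S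

/-- `normalize` is idempotent. -/
theorem normalize_normalize (S : List ℕ) : normalize (normalize S) = normalize S :=
  normalize_eq_self_of_pairwise_lt (normalize_pairwise_lt S)

/-- The list `eraseDups` of a list has the same `toFinset`, and its length is that finset's cardinality. -/
theorem toFinset_eraseDups {α : Type*} [BEq α] [LawfulBEq α] [DecidableEq α] (l : List α) :
    l.eraseDups.toFinset = l.toFinset := by
  ext x
  simp [List.mem_eraseDups]

/-- The length of `l.eraseDups` is the cardinality of `l.toFinset`. -/
theorem length_eraseDups_eq_card {α : Type*} [BEq α] [LawfulBEq α] [DecidableEq α] (l : List α) :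
    l.eraseDups.length = l.toFinset.card := by
  rw [← toFinset_eraseDups, List.toFinset_card_of_nodup (eraseDups_nodup l)]

end Normalize

end Summit.Ventures.HodgeRepro.FaceCensus
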